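import Summits.CriticalPhenomena.PercolationContinuityZ3.Theorems.Transplant.FKConnectivityAllQForestAdjacentSlice
import Summits.CriticalPhenomena.PercolationContinuityZ3.Theorems.Transplant.FKConnectivityAllQForestAdjacentGuard
import HarnessLib

/-!
# The square-free forest slice: R_q⁰ (`TwoClusterRayleighGradedNoSqOn`) ⟹ the guarded square-free adjacent forest Rayleigh
# inequality, and ⟹ the square-free node's inequality on every split fibre with a spare vertex

Support file (`--supports stmt-CriticalPhenomena-4575`), FK sub-lane `prim-bschramm-fk-1` (gen 17) of the post-continuity programme;
builds on p205010 (kernel theorem, internal audit signed; external expert review pending).  No definitions, no named facts, no sorries;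
standard axioms.

After gen 17's kernel refutations of the square-strengthened nodes (`…ForestSquareCex.lean`: `¬ TwoClusterRayleighGradedPos`,
`¬ AdjForestRayleighPos`), the live nodes of this corner are square-free: `TwoClusterRayleighGradedNoSqPos` (R_q⁰, p310496) and
`AdjForestRayleighNoSqPos` (plain coefficientwise forest Rayleigh at an adjacent pair; nearest print: Huang 2023, Thm. 2.1 — adjacent
pairs of the arboreal gas are negatively correlated for all SUFFICIENTLY LARGE `β`; the all-`β`, coefficientwise statement is not in
print).  This file carries p309484's forest-slice arrow over to them:
* **`forestGuardedNoSq_of_gradedNoSqOn`** — `TwoClusterRayleighGradedNoSqOn V →` for every fibre `(M, u₀)` avoiding a vertex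
  `c ∉ {o, v, y}` (with `o, v, y` distinct), `#(G ∩ {ω ∪ {e,f} ∈ Fo}, G ∩ Fo) ≤ #(G ∩ {ω ∪ {e} ∈ Fo}, G ∩ {ω ∪ {f} ∈ Fo})`,
  `G = {e ∉ ω ∧ f ∉ ω}`, `e = ov`, `f = oy` (p309484's proof verbatim with the square term dropped: the two fibre-set inclusions
  bad(♣) ⊆ bad(R_q⁰), good(R_q⁰) ⊆ good(♣) at the forest level `s₀ = 2|V| − 2|u₀| − |M| − 2`);
* **`adjForestNoSq_fibre_of_gradedNoSqOn`** — composed with gen 17's `adjForestNoSq_fibre_of_guarded` (`…ForestAdjacentGuard.lean`):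
  R_q⁰ on `V` gives the square-free node's inequality `#(Fo ∩ J_e ∩ J_f, Fo) ≤ #(Fo ∩ J_e, Fo ∩ J_f)` on every fibre
  `(M ∪ {e,f}, u₀)` with `e, f ∉ M ∪ u₀` that avoids a spare vertex.  (The remaining fibres of `AdjForestRayleighNoSqOn` — `e` or `f`
  in `u₀`, or absent — are identities/trivial; the spare vertex is removed by `Fin n ↪ Fin (n+1)` transport: successor items.)
[cite: CibulkaHladkyLaCroixWagner2008, Thm. 1 (p. 2)] [cite: SempleWelsh2008, Conj. 1.1 (p. 2)] [cite: Grimmett2006, §1.5 eq. (1.22) (p. 13)]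
[cite: Linusson2011, Prop. 2.6] [cite: Huang2023ArborealGas, Thm. 2.1 (p. 2)]
-/

noncomputable section

namespace Summit.CriticalPhenomena.PercolationContinuityZ3.Theorems

namespace FK

open MeasureTheory Set Literature.Probability.LatticeModels Literature.Probability.Percolation
open scoped Classical symmDiff

variable {V : Type*} [Fintype V]

/-- **The square-free forest slice of R_q⁰ (guarded form of (♣)⁰)**: see the file header. [cite: CibulkaHladkyLaCroixWagner2008, Thm. 1 (p. 2)]
[cite: SempleWelsh2008, Conj. 1.1 (p. 2)] [cite: Grimmett2006, §1.5 eq. (1.22) (p. 13)] [cite: Linusson2011, Prop. 2.6] -/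
theorem forestGuardedNoSq_of_gradedNoSqOn (h : TwoClusterRayleighGradedNoSqOn V) {M u₀ : BondConfig V} (hd : Disjoint u₀ M) {o v y c : V}
    (hcM : ∀ g ∈ M, c ∉ g) (hcu : ∀ g ∈ u₀, c ∉ g) (hco : c ≠ o) (hcv : c ≠ v) (hcy : c ≠ y) (hov : o ≠ v) (hoy : o ≠ y) (hvy : v ≠ y) :
    fibreCount M u₀ ({ω | s(o, v) ∉ ω ∧ s(o, y) ∉ ω} ∩ {ω | insert s(o, y) (insert s(o, v) ω) ∈ forestEv V})
        ({ω | s(o, v) ∉ ω ∧ s(o, y) ∉ ω} ∩ forestEv V) ≤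
      fibreCount M u₀ ({ω | s(o, v) ∉ ω ∧ s(o, y) ∉ ω} ∩ {ω | insert s(o, v) ω ∈ forestEv V})
        ({ω | s(o, v) ∉ ω ∧ s(o, y) ∉ ω} ∩ {ω | insert s(o, y) ω ∈ forestEv V}) := by
  set N := Fintype.card V with hN
  have hef : s(o, v) ≠ s(o, y) := fun h' => hvy (Sym2.congr_right.1 h')
  -- isolation of `c` on the fibre
  have iso : ∀ {ω : BondConfig V}, ω \ M = u₀ → ∀ g ∈ ω, c ∉ g := fun hω g hg =>
    (mem_union_of_fibre hω hg).elim (hcM g) (hcu g)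
  have isoM : ∀ {ω : BondConfig V}, ω \ M = u₀ → ∀ g ∈ ω ∆ M, c ∉ g := fun hω g hg =>
    (mem_union_of_fibre_symmDiff hω hg).elim (hcM g) (hcu g)
  have hce : c ∉ s(o, v) := by rw [Sym2.mem_iff]; rintro (rfl | rfl) <;> [exact hco rfl; exact hcv rfl]
  have isoE : ∀ {ω : BondConfig V}, ω \ M = u₀ → ∀ g ∈ insert s(o, v) ω, c ∉ g := by
    intro ω hω g hg
    rcases mem_insert_iff.1 hg with rfl | hg
    · exact hce
    · exact iso hω g hg
  have hcf' : c ∈ s(c, y) := Sym2.mem_mk_left c y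
  -- degenerate fibres: a pinned pair inside the fibre kills the guard on one side
  by_cases htouch : s(o, v) ∈ M ∨ s(o, v) ∈ u₀ ∨ s(o, y) ∈ M ∨ s(o, y) ∈ u₀
  · have hz : ∀ (A B : Set (BondConfig V)),
        fibreCount M u₀ ({ω | s(o, v) ∉ ω ∧ s(o, y) ∉ ω} ∩ A) ({ω | s(o, v) ∉ ω ∧ s(o, y) ∉ ω} ∩ B) = 0 := by
      intro A B
      refine fibreCount_eq_zero_of_forall _ _ _ _ fun ω hω h1 h2 => ?_
      have hsub : u₀ ⊆ ω := by rw [← hω]; exact Set.sdiff_subset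
      have key : ∀ g : Sym2 V, g ∈ M ∨ g ∈ u₀ → g ∉ ω → g ∉ ω ∆ M → False := by
        intro g hg hgω hgωM
        rcases hg with hgM | hgu
        · exact hgωM (Set.mem_symmDiff.2 (Or.inr ⟨hgM, hgω⟩))
        · exact hgω (hsub hgu)
      rcases htouch with h' | h' | h' | h'
      · exact key _ (Or.inl h') h1.1.1 h2.1.1
      · exact key _ (Or.inr h') h1.1.1 h2.1.1
      · exact key _ (Or.inl h') h1.1.2 h2.1.2
      · exact key _ (Or.inr h') h1.1.2 h2.1.2
    rw [hz]
    exact Nat.zero_le _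
  simp only [not_or] at htouch
  obtain ⟨heM, heu, hfM, hfu⟩ := htouch
  have hfω : ∀ {ω : BondConfig V}, ω \ M = u₀ → s(o, y) ∉ ω := fun hω hf =>
    (mem_union_of_fibre hω hf).elim hfM hfu
  have hfωM : ∀ {ω : BondConfig V}, ω \ M = u₀ → s(o, y) ∉ ω ∆ M := fun hω hf =>
    (mem_union_of_fibre_symmDiff hω hf).elim hfM hfu
  -- the graded node at the fresh vertex and the forest level
  set s₀ : ℕ := 2 * N - (2 * u₀.ncard + M.ncard) - 2 with hs₀
  have I := h M u₀ hd o c o v c y s₀ (SimpleGraph.Reachable.refl _) (SimpleGraph.Reachable.refl _)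
  -- collapse the three graded counts to single fibre counts with a level constraint
  rw [gradedCount_collapse M u₀ (A' := {ω | s(o, v) ∉ ω ∧ s(c, y) ∉ ω} ∩ {ω | insert s(c, y) (insert s(o, v) ω) ∈ sepEv o c})
      (B' := {ω | s(o, v) ∉ ω ∧ s(c, y) ∉ ω} ∩ sepEv o c) (κ₁ := fun ω => clusterCount (insert s(c, y) (insert s(o, v) ω)) ∅)
      (κ₂ := fun ω => clusterCount ω ∅)
      (fun i ω => by simp only [mem_inter_iff, mem_setOf_eq, mem_levelSet_iff, and_assoc])
      (fun j ω => by simp only [mem_inter_iff, mem_setOf_eq, mem_levelSet_iff, and_assoc])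
      (fun ω => clusterCount_empty_le_card _) (fun ω => clusterCount_empty_le_card _),
    gradedCount_collapse M u₀ (A' := {ω | s(o, v) ∉ ω ∧ s(c, y) ∉ ω} ∩ {ω | insert s(o, v) ω ∈ sepEv o c})
      (B' := {ω | s(o, v) ∉ ω ∧ s(c, y) ∉ ω} ∩ {ω | insert s(c, y) ω ∈ sepEv o c}) (κ₁ := fun ω => clusterCount (insert s(o, v) ω) ∅)
      (κ₂ := fun ω => clusterCount (insert s(c, y) ω) ∅)
      (fun i ω => by simp only [mem_inter_iff, mem_setOf_eq, mem_levelSet_iff, and_assoc])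
      (fun j ω => by simp only [mem_inter_iff, mem_setOf_eq, mem_levelSet_iff, and_assoc])
      (fun ω => clusterCount_empty_le_card _) (fun ω => clusterCount_empty_le_card _)] at I
  -- (1) bad(♣) ⊆ bad(R_q) at the forest level
  have hbad : fibreCount M u₀ ({ω | s(o, v) ∉ ω ∧ s(o, y) ∉ ω} ∩ {ω | insert s(o, y) (insert s(o, v) ω) ∈ forestEv V})
        ({ω | s(o, v) ∉ ω ∧ s(o, y) ∉ ω} ∩ forestEv V) ≤
      fibreCount M u₀ (({ω | s(o, v) ∉ ω ∧ s(c, y) ∉ ω} ∩ {ω | insert s(c, y) (insert s(o, v) ω) ∈ sepEv o c}) ∩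
          {ω | clusterCount (insert s(c, y) (insert s(o, v) ω)) ∅ + clusterCount (ω ∆ M) ∅ = s₀})
        ({ω | s(o, v) ∉ ω ∧ s(c, y) ∉ ω} ∩ sepEv o c) := by
    refine fibreCount_mono_fibre M u₀ fun ω hω h1 h2 => ?_
    obtain ⟨⟨heω, -⟩, hF⟩ := h1
    obtain ⟨⟨heωM, -⟩, hF2⟩ := h2
    have hF' : IsForestCfg (insert s(o, y) (insert s(o, v) ω)) := hF
    have hF2' : IsForestCfg (ω ∆ M) := hF2
    have hfX : s(o, y) ∉ insert s(o, v) ω := by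
      rw [mem_insert_iff, not_or]; exact ⟨hef.symm, hfω hω⟩
    obtain ⟨hX, hoy'⟩ := (isForestCfg_insert_iff hoy hfX).1 hF'
    -- levels
    have k1 := clusterCount_insert_isolated (isoE hω) hcy
    have n1 := (isForestCfg_iff_ncard_add _).1 hX
    have n2 := (isForestCfg_iff_ncard_add _).1 hF2'
    have nins : (insert s(o, v) ω).ncard = ω.ncard + 1 := Set.ncard_insert_of_notMem heω (Set.toFinite _)
    have nT := ncard_add_ncard_symmDiff hd hω
    refine ⟨⟨⟨⟨heω, fun hf' => iso hω _ hf' hcf'⟩, ?_⟩, ?_⟩, ⟨heωM, fun hf' => isoM hω _ hf' hcf'⟩, ?_⟩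
    · show ¬ (openGraph (insert s(c, y) (insert s(o, v) ω))).Reachable o c
      rw [reachable_insert_isolated_iff (isoE hω) hco]; exact hoy'
    · show clusterCount (insert s(c, y) (insert s(o, v) ω)) ∅ + clusterCount (ω ∆ M) ∅ = s₀
      rw [hs₀, hN]; omega
    · exact not_reachable_of_isolated' (isoM hω) hco.symm
  -- (2) good(R_q) at the forest level ⊆ good(♣)
  have hgood : fibreCount M u₀ (({ω | s(o, v) ∉ ω ∧ s(c, y) ∉ ω} ∩ {ω | insert s(o, v) ω ∈ sepEv o c}) ∩
          {ω | clusterCount (insert s(o, v) ω) ∅ + clusterCount (insert s(c, y) (ω ∆ M)) ∅ = s₀})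
        ({ω | s(o, v) ∉ ω ∧ s(c, y) ∉ ω} ∩ {ω | insert s(c, y) ω ∈ sepEv o c}) ≤
      fibreCount M u₀ ({ω | s(o, v) ∉ ω ∧ s(o, y) ∉ ω} ∩ {ω | insert s(o, v) ω ∈ forestEv V})
        ({ω | s(o, v) ∉ ω ∧ s(o, y) ∉ ω} ∩ {ω | insert s(o, y) ω ∈ forestEv V}) := by
    refine fibreCount_mono_fibre M u₀ fun ω hω h1 h2 => ?_
    obtain ⟨⟨⟨heω, -⟩, -⟩, hlev⟩ := h1
    obtain ⟨⟨heωM, -⟩, hsep⟩ := h2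
    have hlev' : clusterCount (insert s(o, v) ω) ∅ + clusterCount (insert s(c, y) (ω ∆ M)) ∅ = s₀ := hlev
    have hsep' : ¬ (openGraph (insert s(c, y) (ω ∆ M))).Reachable o c := hsep
    rw [reachable_insert_isolated_iff (isoM hω) hco] at hsep'
    have k2 := clusterCount_insert_isolated (isoM hω) hcy
    have d1 := ncard_add_clusterCount_eq (insert s(o, v) ω)
    have d2 := ncard_add_clusterCount_eq (ω ∆ M)
    have nins : (insert s(o, v) ω).ncard = ω.ncard + 1 := Set.ncard_insert_of_notMem heω (Set.toFinite _)
    have nT := ncard_add_ncard_symmDiff hd hω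
    have k1pos := one_le_clusterCount o (insert s(o, v) ω)
    have hdefi : defi (insert s(o, v) ω) = 0 ∧ defi (ω ∆ M) = 0 := by
      rw [hs₀, hN] at hlev'; constructor <;> omega
    have hX : IsForestCfg (insert s(o, v) ω) := (defi_eq_zero_iff _).1 hdefi.1
    have hY : IsForestCfg (ω ∆ M) := (defi_eq_zero_iff _).1 hdefi.2
    refine ⟨⟨⟨heω, hfω hω⟩, hX⟩, ⟨heωM, hfωM hω⟩, ?_⟩
    show IsForestCfg (insert s(o, y) (ω ∆ M))
    exact (isForestCfg_insert_iff hoy (hfωM hω)).2 ⟨hY, hsep'⟩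
  omega

/-- **R_q⁰ ⟹ the square-free adjacent forest Rayleigh inequality on split fibres with a spare vertex**: for `e = ov`, `f = oy` outside
`M ∪ u₀` and a vertex `c ∉ {o,v,y}` untouched by `M ∪ u₀`, `#_{(M∪{e,f},u₀)}(Fo ∩ J_e ∩ J_f, Fo) ≤ #_{(M∪{e,f},u₀)}(Fo ∩ J_e, Fo ∩ J_f)`.
[cite: SempleWelsh2008, Conj. 1.1 (p. 2)] [cite: CibulkaHladkyLaCroixWagner2008, Thm. 1 (p. 2)] -/
theorem adjForestNoSq_fibre_of_gradedNoSqOn (h : TwoClusterRayleighGradedNoSqOn V) {M u₀ : BondConfig V} (hd : Disjoint u₀ M)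
    {o v y c : V} (hcM : ∀ g ∈ M, c ∉ g) (hcu : ∀ g ∈ u₀, c ∉ g) (hco : c ≠ o) (hcv : c ≠ v) (hcy : c ≠ y) (hov : o ≠ v)
    (hoy : o ≠ y) (hvy : v ≠ y) (heM : s(o, v) ∉ M) (hfM : s(o, y) ∉ M) :
    fibreCount (insert s(o, y) (insert s(o, v) M)) u₀ (forestEv V ∩ {ω | s(o, v) ∈ ω ∧ s(o, y) ∈ ω}) (forestEv V) ≤
      fibreCount (insert s(o, y) (insert s(o, v) M)) u₀ (forestEv V ∩ {ω | s(o, v) ∈ ω}) (forestEv V ∩ {ω | s(o, y) ∈ ω}) :=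
  adjForestNoSq_fibre_of_guarded hvy heM hfM (forestGuardedNoSq_of_gradedNoSqOn h hd hcM hcu hco hcv hcy hov hoy hvy)

end FK

end Summit.CriticalPhenomena.PercolationContinuityZ3.Theorems

end
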